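import Summits.SmoothPoincare4.SmoothPoincare4.Theorems.EntropyRungBakryEmeryLogSobolevStampacchia
import Summits.SmoothPoincare4.SmoothPoincare4.Theorems.EntropyRungBakryEmeryLogSobolevGaffneyEnergy
import Summits.SmoothPoincare4.SmoothPoincare4.Theorems.EntropyRungBakryEmeryLogSobolevGradientBound
import HarnessLib

/-!
# A-priori bounds for the energy-class weighted heat flow on a complete `CD(K,∞)` manifold
# (support item `EntropyRung.BakryEmeryLogSobolev`, stmt-SmoothPoincare4-16587)

Setting: `M` modelled on `ℝⁿ` (Hausdorff, second countable, `T₃`, Borel — NOT compact), `g` Riemannian with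
its Levi-Civita connection, `V` smooth (NO growth assumption), `Ric_g + Hess V ≥ K g`,
`L = Δ_g − g⁻¹(dV, d·)`, monotone Gaffney cut-offs `η_k`.

`gaffney_apriori` — for `u` smooth on `M × O` (`O ⊇ [0, T]` open) with `∂ₛu = Lu` on `[0, T]`,
`a ≤ u(0) ≤ b`, `a ≤ c ≤ b`, `(u − c)² e^{-V} ∈ L¹(M × (0,T))`, `(u(0) − c)² e^{-V} ∈ L¹(M)` and
`|∇u(0)|² ≤ G₀`: `a ≤ u ≤ b` and `|∇u(s)|² ≤ e^{-2Ks} G₀` on `[0, T] × M`. The two-sided bound is the weak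
maximum principle `gaffney_maxPrinciple` for `u − b` and `a − u` (`L(αu + β) = αLu`,
`(αu + β)₊² ≤ (u − c)²`); the gradient bound is `gaffney_gradientDecay`, whose integrability proviso
`|∇u|² e^{-V} ∈ L¹(M × (0,T))` is the energy inequality `gaffney_energyEstimate`.
Everything is proved; no definitions.

## References

* [Grigoryan2009] A. Grigor'yan (2009), §11.4 and §12.1 (uniqueness class / maximum principle).
* [BakryGentilLedoux2014] D. Bakry, I. Gentil, M. Ledoux (2014), Thm. 3.2.3/3.2.4 (pp. 143–146).
-/

noncomputable section

set_option linter.dupNamespace false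

open scoped Manifold ContDiff ENNReal NNReal Topology
open MeasureTheory Set Filter
open Literature.Geometry.Lorentzian Literature.Geometry.Riemannian

namespace Summit.SmoothPoincare4.SmoothPoincare4.Theorems.BakryEmeryComplete

open NoncompactShrinkerGapHeat NoncompactShrinkerGapHeat.CutoffToolkit

section APriori

variable {n : ℕ} {M : Type*} [TopologicalSpace M] [T2Space M] [SecondCountableTopology M]
  [ChartedSpace (EuclideanSpace ℝ (Fin n)) M] [IsManifold (𝓡 n) ∞ M] [T3Space M]
  [MeasurableSpace M] [BorelSpace M]
  {g : PseudoRiemannianMetric (𝓡 n) ∞ (EuclideanSpace ℝ (Fin n)) (TangentSpace (𝓡 n) : M → Type _)}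
  [g.HasLeviCivita]

/-- **A-priori bounds along the energy-class weighted heat flow** (see the module docstring):
two-sided bounds `a ≤ u ≤ b` and the Bakry–Émery gradient decay `|∇u(s)|² ≤ e^{-2Ks} G₀` on `[0,T] × M`.
[cite: Grigoryan2009, §11.4, §12.1] [cite: BakryGentilLedoux2014, Thm. 3.2.3/3.2.4 (pp. 143–146)] -/
theorem gaffney_apriori (hg : g.IsRiemannian) {V : M → ℝ} {K : ℝ} (hV : ContMDiff (𝓡 n) 𝓘(ℝ, ℝ) ∞ V)
    (hRic : ∀ (y : M) (X : TangentSpace (𝓡 n) y), K * g.val y X X ≤ g.ricci y X X + g.hessian V y X X)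
    {η : ℕ → M → ℝ} {C₀ : ℝ} (hηs : ∀ k, ContMDiff (𝓡 n) 𝓘(ℝ, ℝ) ∞ (η k))
    (hηc : ∀ k, HasCompactSupport (η k)) (hη01 : ∀ k x, 0 ≤ η k x ∧ η k x ≤ 1)
    (hηmono : ∀ k x, η k x ≤ η (k + 1) x) (hη1 : ∀ x, ∀ᶠ k in atTop, η k x = 1)
    (hηgrad : ∀ k x, g.gradSq (η k) x ≤ C₀ / ((k : ℝ) + 1) ^ 2)
    {T : ℝ} {O : Set ℝ} {u : ℝ → M → ℝ} (hT : 0 < T) (hO : IsOpen O) (hTO : Icc 0 T ⊆ O)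
    (hu : ContMDiffOn ((𝓡 n).prod 𝓘(ℝ, ℝ)) 𝓘(ℝ, ℝ) ∞ (fun p : M × ℝ ↦ u p.2 p.1) (univ ×ˢ O))
    (heq : ∀ s ∈ Icc 0 T, ∀ x, deriv (fun r ↦ u r x) s = g.dalembertian (u s) x
      - g.innerDual x (mvfderiv (𝓡 n) V x).toLinearMap (mvfderiv (𝓡 n) (u s) x).toLinearMap)
    {a b c G₀ : ℝ} (hac : a ≤ c) (hcb : c ≤ b) (h0ab : ∀ x, a ≤ u 0 x ∧ u 0 x ≤ b)
    (hG₀ : ∀ x, g.gradSq (u 0) x ≤ G₀)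
    (hint : Integrable (fun p : M × ℝ ↦ (u p.2 p.1 - c) ^ 2 * Real.exp (-V p.1))
      ((g.riemVolume.prod (volume : Measure ℝ)).restrict (univ ×ˢ Ioo 0 T)))
    (h0 : Integrable (fun x ↦ (u 0 x - c) ^ 2 * Real.exp (-V x)) g.riemVolume) :
    (∀ s ∈ Icc 0 T, ∀ x, a ≤ u s x ∧ u s x ≤ b) ∧
      ∀ s ∈ Icc 0 T, ∀ x, g.gradSq (u s) x ≤ Real.exp (-2 * K * s) * G₀ := by
  set μ : Measure M := g.riemVolume with hμ
  set ν : Measure (M × ℝ) := (μ.prod (volume : Measure ℝ)).restrict (univ ×ˢ Ioo 0 T) with hν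
  have hexpc : Continuous fun y ↦ Real.exp (-V y) := Real.continuous_exp.comp hV.continuous.neg
  -- regularity of `u`
  have hus : ∀ r ∈ O, ContMDiff (𝓡 n) 𝓘(ℝ, ℝ) ∞ (u r) := fun r hr ↦ contMDiff_slice_of_contMDiffOn hu hr
  have hud : ∀ r ∈ O, ∀ y, HasDerivAt (fun r' ↦ u r' y) (deriv (fun r' ↦ u r' y) r) r := fun r hr y ↦
    hasDerivAt_time hO hu y hr
  -- the maximum principle for the affine images `α u + β`
  have key : ∀ α β : ℝ, (∀ y, α * u 0 y + β ≤ 0) → (∀ r y, α * u r y + β ≤ |u r y - c|) →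
      ∀ s ∈ Icc 0 T, ∀ x, α * u s x + β ≤ 0 := by
    intro α β hz0 hle
    set z : ℝ → M → ℝ := fun r y ↦ α * u r y + β with hz
    have hzs : ContMDiffOn ((𝓡 n).prod 𝓘(ℝ, ℝ)) 𝓘(ℝ, ℝ) ∞ (fun p : M × ℝ ↦ z p.2 p.1) (univ ×ˢ O) :=
      (contMDiffOn_const.mul hu).add contMDiffOn_const
    have heqz : ∀ r ∈ Icc 0 T, ∀ y, deriv (fun r' ↦ z r' y) r = g.dalembertian (z r) y -
        g.innerDual y (mvfderiv (𝓡 n) V y).toLinearMap (mvfderiv (𝓡 n) (z r) y).toLinearMap := by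
      intro r hr y
      have hrO := hTO hr
      have hd : HasDerivAt (fun r' ↦ z r' y) (α * deriv (fun r' ↦ u r' y) r) r :=
        ((hud r hrO y).const_mul α).add_const β
      have h2 : ContMDiffAt (𝓡 n) 𝓘(ℝ, ℝ) 2 (u r) y :=
        ((hus r hrO).of_le (WithTop.coe_le_coe.mpr le_top)).contMDiffAt
      have hLz := weightedLaplacian_affine (g := g) (V := V) h2 α β
      rw [hd.deriv, show z r = fun y' ↦ α * u r y' + β from rfl, hLz, heq r hr y]
    have hint' : Integrable (fun p : M × ℝ ↦ max (z p.2 p.1) 0 ^ 2 * Real.exp (-V p.1)) ν := by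
      refine hint.mono' ?_ (ae_of_all _ fun p ↦ ?_)
      · have hcont : ContinuousOn (fun p : M × ℝ ↦ max (z p.2 p.1) 0 ^ 2 * Real.exp (-V p.1)) (univ ×ˢ O) :=
          ((hzs.continuousOn.sup continuousOn_const).pow 2).mul (hexpc.comp continuous_fst).continuousOn
        exact (hcont.mono (prod_mono le_rfl (Ioo_subset_Icc_self.trans hTO))).aestronglyMeasurable
          (MeasurableSet.univ.prod measurableSet_Ioo)
      · have hex := Real.exp_pos (-V p.1)
        have h1 : max (z p.2 p.1) 0 ≤ |u p.2 p.1 - c| := max_le (hle _ _) (abs_nonneg _)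
        have h2 : max (z p.2 p.1) 0 ^ 2 ≤ (u p.2 p.1 - c) ^ 2 := by
          rw [← sq_abs (u p.2 p.1 - c)]
          exact pow_le_pow_left₀ (le_max_right _ _) h1 2
        rw [Real.norm_eq_abs, abs_of_nonneg (mul_nonneg (sq_nonneg _) hex.le)]
        exact mul_le_mul_of_nonneg_right h2 hex.le
    exact gaffney_maxPrinciple hg hV hηs hηc hη01 hηmono hη1 hηgrad hO hTO hzs heqz hz0 hint'
  have hab : ∀ s ∈ Icc 0 T, ∀ x, a ≤ u s x ∧ u s x ≤ b := by
    intro s hs x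
    refine ⟨?_, ?_⟩
    · have h := key (-1) a (fun y ↦ by linarith [(h0ab y).1])
        (fun r y ↦ by linarith [neg_abs_le (u r y - c)]) s hs x
      linarith
    · have h := key 1 (-b) (fun y ↦ by linarith [(h0ab y).2])
        (fun r y ↦ by linarith [le_abs_self (u r y - c)]) s hs x
      linarith
  refine ⟨hab, ?_⟩
  -- the energy inequality gives `|∇u|² e^{-V} ∈ L¹(M × (0,T))`, then the gradient decay
  have hE := (gaffney_energyEstimate hg hV hηs hηc hη01 hη1 hηgrad hT hO hTO hu heq c hint h0).1
  exact gaffney_gradientDecay hg hV hRic hηs hηc hη01 hηmono hη1 hηgrad hO hTO hu heq hE hG₀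

end APriori

end Summit.SmoothPoincare4.SmoothPoincare4.Theorems.BakryEmeryComplete

end
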